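import Literature.AnabelianGeometry.SemiGraphs.PSCVertexSetBijections
import Literature.AnabelianGeometry.SemiGraphs.PSCGraphicProofs
import HarnessLib

/-!
# [CombGC] Thm. 1.6 (ii), descent step: the bijection of vertex sets induced by a VERTEX-GRAPHIC
# quotient isomorphism is automatically Galois-equivariant ("functorial"), hence `α` is
# group-theoretically verticial

Mochizuki, *A combinatorial version of the Grothendieck conjecture*, Tohoku Math. J. **59** (2007) [CombGC],
proof of Theorem 1.6 (ii), author's ms p. 14 l.18–28: after "replacing `G`, `H` by their respective
compactifications … and replacing `α` by the isomorphism induced by `α` between the respective quotients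
`Π_G ↠ Π^cpt_G`, `Π_H ↠ Π^cpt_H`", "to prove that `α` is group-theoretically verticial, it suffices to prove
[cf. the proof of assertion (i)] that `α` induces a functorial bijection between the sets of vertices of
`G`, `H`" (render `paper:url-6994f81053dc` p0014); with Proposition 1.2 (i) p. 8 (distinct vertices have
representative subgroups with non-open mutual intersection). [cite: MochizukiCombGC2007, Thm 1.6(ii) p.14]

PROOF-ONLY file (abc-iut cell, layer L3, `plan/L3/SUBDAG-CombGC-Thm16.md` rows **T16-L09b-E1/E2/E3**,
holder abc-iut-w5-d188, writer's ruling v5 04:05:53Z; sequel to p420865 / p421305).  The DESCENT from the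
level-wise (possibly QUOTIENT-level) vertex correspondences to `α` itself, entirely at the level of
`Π_G`, `Π_H` (no quotient groups are formed here — the kernel of the quotient enters as a normal subgroup
`K' ≤ Π_H` modulo which the correspondence is known).  Generic over finite families `S : ι → Subgroup Π_G`,
`T : ι' → Subgroup Π_H` (vertices / cusps / edges).  At a level `U` (open normal, `U' := α U`):

* the `S`-objects of `G_U` over `i` are the double cosets `U x (S i)` (`DoubleCoset.Quotient`), with
  representative subgroups `U ⊓ (S i)^x ≤ Π_{G_U} = U`; a bijection `e : Obj_S(G_U) ≃ Obj_T(H_{U'})` is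
  **`α`-GRAPHIC MODULO `K'`** if for corresponding objects `U x S i ↦ U' y T j` the subgroup
  `α(U ⊓ (S i)^x) · K'` is a `U'`-conjugate of `(U' ⊓ (T j)^y) · K'` — this is what "the isomorphism induced
  by `α` between the quotients is graphic" says about vertices when `K'` is (the image in `Π_H` of) the
  kernel `Ker(Π_{H_{U'}} ↠ Π^cpt)` (and with `K' = 1` what "`α|_U` is graphic" says);
* **`equivariant_of_graphic_mod`** — if moreover distinct `T`-objects of `H_{U'}` have representative
  subgroups that are NOT `U'`-conjugate modulo `K'` (Prop. 1.2 (i) for the level-`U'` [quotient] datum —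
  hypothesis `hsep`), then `e` is `α`-EQUIVARIANT for the Galois actions: `e(U (g x) S i) = α(g) · e(U x S i)`.
  Proof: `α(U ⊓ (S i)^{g x}) = α(g) · α(U ⊓ (S i)^x) · α(g)⁻¹` (`U` normal), so both `e(U g x S i)` and
  `α(g) · e(U x S i)` have representative subgroups `U'`-conjugate modulo `K'` to the same subgroup; `hsep`.
* **`transport_of_graphic_mod`**, **`isGroupTheoreticallyVerticial_of_graphic_mod`**,
  **`isGroupTheoreticallyCuspidal_of_graphic_mod`**, **`isGroupTheoreticallyEdgeLike_of_graphic_mod`** —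
  hence (p421305 `transport_of_equivariant_bijections`, p420865): if at EVERY level such an `α`-graphic-mod-`K'_U`
  bijection with `hsep` exists, `α` is group-theoretically verticial / cuspidal / edge-like (Def. 1.4 (iv)).
This is row T16-L09b's descent in kernel form; what remains for the assembly of Thm. 1.6 (ii) is to read
the two hypotheses off the compactified coverings `(G_U)'`, `(H_{U'})'` (abc-iut-L3-t4's `restrict` /
`compactifyAlong`, p417678 / p418457) — an unwinding of `subgroupOf` / quotient images, no new idea.  Pure
group theory; no definitions; no statement of [CombGC] is asserted; nothing here takes a side on
[IUTchIII] Cor. 3.12.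
-/

noncomputable section

namespace Literature.AnabelianGeometry.SemiGraphs

namespace PSCDatum

open scoped Pointwise

universe u

variable {P : Type u} [Group P] [TopologicalSpace P]
variable {P' : Type u} [Group P'] [TopologicalSpace P']

/-! ### 1. Conjugation bookkeeping -/

omit [TopologicalSpace P] in
/-- `g · (U ⊓ X) · g⁻¹ = U ⊓ g X g⁻¹` for `U` normal. [cite: MochizukiCombGC2007, Def 1.1(ii) p.6] -/
theorem conjAct_smul_inf_of_normal {U : Subgroup P} (hU : U.Normal) (g : ConjAct P) (X : Subgroup P) :
    g • (U ⊓ X) = U ⊓ g • X := by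
  rw [Subgroup.smul_inf, hU.conjAct g]

omit [TopologicalSpace P] in
/-- `g · (X ⊔ K) · g⁻¹ = g X g⁻¹ ⊔ K` for `K` normal. [cite: MochizukiCombGC2007, Def 1.1(ii) p.6] -/
theorem conjAct_smul_sup_of_normal {K : Subgroup P} (hK : K.Normal) (g : ConjAct P) (X : Subgroup P) :
    g • (X ⊔ K) = g • X ⊔ K := by
  rw [Subgroup.smul_sup, hK.conjAct g]

omit [TopologicalSpace P] in
/-- Representatives of the same double coset `U x K = U x' K` give `U`-CONJUGATE representative subgroups:
`U ⊓ K^{x'} = u · (U ⊓ K^x) · u⁻¹`. [cite: MochizukiCombGC2007, Def 1.1(ii) p.6] -/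
theorem exists_conj_of_mk_eq {U : Subgroup P} (hU : U.Normal) (K : Subgroup P) {x x' : P}
    (h : DoubleCoset.mk U K x = DoubleCoset.mk U K x') :
    ∃ u ∈ U, U ⊓ ConjAct.toConjAct x' • K = ConjAct.toConjAct u • (U ⊓ ConjAct.toConjAct x • K) := by
  obtain ⟨u, hu, k, hk, rfl⟩ := (DoubleCoset.eq U K x x').mp h
  refine ⟨u, hu, ?_⟩
  rw [conjAct_smul_inf_of_normal hU, ← mul_smul, ← map_mul]
  congr 1
  rw [map_mul, mul_smul, Subgroup.conjAct_pointwise_smul_eq_self (Subgroup.le_normalizer hk)]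

/-! ### 2. A bijection graphic modulo `K'` is equivariant -/

section OneLevel

variable (α : P ≃ₜ* P') {ι ι' : Type*} (S : ι → Subgroup P) (T : ι' → Subgroup P')

/-- **Equivariance of an `α`-graphic-mod-`K'` bijection of level-`U` objects** (row T16-L09b, E1–E3):
see the module docstring.  `U` normal in `Π_G`, `U'` normal in `Π_H` (intended: `U' = α U`, though the
argument does not use it), `K'` normal in `Π_H`; `e` a bijection between
the `S`-objects of `G_U` and the `T`-objects of `H_{U'}` that is `α`-graphic modulo `K'` (`he`); distinct
`T`-objects have representative subgroups not `U'`-conjugate modulo `K'` (`hsep`).  Then `e` is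
`α`-equivariant for the Galois actions by left multiplication. [cite: MochizukiCombGC2007, Thm 1.6(ii) p.14] -/
theorem equivariant_of_graphic_mod {U : Subgroup P} (hU : U.Normal) {U' : Subgroup P'} (hU' : U'.Normal)
    {K' : Subgroup P'} (hK' : K'.Normal)
    (e : (Σ i, DoubleCoset.Quotient (U : Set P) (S i : Set P)) ≃
      (Σ j, DoubleCoset.Quotient (U' : Set P') (T j : Set P')))
    (he : ∀ (i : ι) (x : P) (j : ι') (y : P'),
      e ⟨i, DoubleCoset.mk U (S i) x⟩ = ⟨j, DoubleCoset.mk U' (T j) y⟩ →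
        ∃ u' ∈ U', (U ⊓ ConjAct.toConjAct x • S i).map α.toMulEquiv.toMonoidHom ⊔ K' =
          ConjAct.toConjAct u' • ((U' ⊓ ConjAct.toConjAct y • T j) ⊔ K'))
    (hsep : ∀ (j₁ : ι') (y₁ : P') (j₂ : ι') (y₂ : P'),
      (∃ u' ∈ U', (U' ⊓ ConjAct.toConjAct y₁ • T j₁) ⊔ K' =
          ConjAct.toConjAct u' • ((U' ⊓ ConjAct.toConjAct y₂ • T j₂) ⊔ K')) →
        (⟨j₁, DoubleCoset.mk U' (T j₁) y₁⟩ : Σ j, DoubleCoset.Quotient (U' : Set P') (T j : Set P')) =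
          ⟨j₂, DoubleCoset.mk U' (T j₂) y₂⟩)
    (g x : P) (i : ι) (j : ι') (y : P')
    (hxy : e ⟨i, DoubleCoset.mk U (S i) x⟩ = ⟨j, DoubleCoset.mk U' (T j) y⟩) :
    e ⟨i, DoubleCoset.mk U (S i) (g * x)⟩ = ⟨j, DoubleCoset.mk U' (T j) (α g * y)⟩ := by
  -- the image of the translated object, with a representative `ỹ`
  rcases hgx : e ⟨i, DoubleCoset.mk U (S i) (g * x)⟩ with ⟨j₁, q₁⟩
  obtain ⟨y₁, rfl⟩ : ∃ y₁, DoubleCoset.mk U' (T j₁) y₁ = q₁ := ⟨q₁.out, DoubleCoset.out_eq' _ _ q₁⟩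
  -- graphicity modulo `K'` at the two objects
  obtain ⟨u₁, hu₁, h₁⟩ := he i (g * x) j₁ y₁ hgx
  obtain ⟨u₂, hu₂, h₂⟩ := he i x j y hxy
  apply hsep j₁ y₁ j (α g * y)
  -- `α(U ⊓ (S i)^{g x}) = α g · α(U ⊓ (S i)^x) · (α g)⁻¹`
  have hconj : (U ⊓ ConjAct.toConjAct (g * x) • S i).map α.toMulEquiv.toMonoidHom =
      ConjAct.toConjAct (α g) • (U ⊓ ConjAct.toConjAct x • S i).map α.toMulEquiv.toMonoidHom := by
    rw [map_mul, mul_smul, ← conjAct_smul_inf_of_normal hU, map_conj_smul, ConjAct.ofConjAct_toConjAct]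
    rfl
  -- `u₃ := (α g) u₂ (α g)⁻¹ ∈ U'`
  have hu₃ : α g * u₂ * (α g)⁻¹ ∈ U' := hU'.conj_mem u₂ hu₂ (α g)
  refine ⟨u₁⁻¹ * (α g * u₂ * (α g)⁻¹), U'.mul_mem (U'.inv_mem hu₁) hu₃, ?_⟩
  have step1 : (U' ⊓ ConjAct.toConjAct y₁ • T j₁) ⊔ K' =
      ConjAct.toConjAct u₁⁻¹ •
        ((U ⊓ ConjAct.toConjAct (g * x) • S i).map α.toMulEquiv.toMonoidHom ⊔ K') := by
    rw [h₁, ← mul_smul, ← map_mul, inv_mul_cancel, map_one, one_smul]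
  have step2 : ConjAct.toConjAct (α g) • ((U' ⊓ ConjAct.toConjAct y • T j) ⊔ K') =
      (U' ⊓ ConjAct.toConjAct (α g * y) • T j) ⊔ K' := by
    rw [conjAct_smul_sup_of_normal hK', conjAct_smul_inf_of_normal hU', ← mul_smul, ← map_mul]
  calc (U' ⊓ ConjAct.toConjAct y₁ • T j₁) ⊔ K'
      = ConjAct.toConjAct u₁⁻¹ •
          ((U ⊓ ConjAct.toConjAct (g * x) • S i).map α.toMulEquiv.toMonoidHom ⊔ K') := step1
    _ = ConjAct.toConjAct u₁⁻¹ • (ConjAct.toConjAct (α g) •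
          ((U ⊓ ConjAct.toConjAct x • S i).map α.toMulEquiv.toMonoidHom ⊔ K')) := by
          rw [hconj, ← conjAct_smul_sup_of_normal hK' (ConjAct.toConjAct (α g))]
    _ = ConjAct.toConjAct u₁⁻¹ • (ConjAct.toConjAct (α g) • (ConjAct.toConjAct u₂ •
          ((U' ⊓ ConjAct.toConjAct y • T j) ⊔ K'))) := by rw [h₂]
    _ = ConjAct.toConjAct u₁⁻¹ • (ConjAct.toConjAct (α g * u₂ * (α g)⁻¹) •
          (ConjAct.toConjAct (α g) • ((U' ⊓ ConjAct.toConjAct y • T j) ⊔ K'))) := by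
          simp only [smul_smul, ← map_mul]
          congr 2
          group
    _ = ConjAct.toConjAct (u₁⁻¹ * (α g * u₂ * (α g)⁻¹)) •
          ((U' ⊓ ConjAct.toConjAct (α g * y) • T j) ⊔ K') := by
          rw [step2, ← mul_smul, ← map_mul]

end OneLevel

/-! ### 3. All levels: `α` is group-theoretically verticial / cuspidal / edge-like -/

section AllLevels

variable [IsTopologicalGroup P] [CompactSpace P] [TotallyDisconnectedSpace P]
variable [IsTopologicalGroup P'] [CompactSpace P'] [TotallyDisconnectedSpace P']
variable (α : P ≃ₜ* P')

/-- **Level-wise `α`-graphic-mod-`K'_U` bijections of `S`/`T`-objects with separation ⇒ `α` transports the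
`S`-classes onto the `T`-classes** (generic form of the descent). [cite: MochizukiCombGC2007, Thm 1.6(ii) p.14] -/
theorem transport_of_graphic_mod {ι ι' : Type*} [Finite ι] [Finite ι'] (S : ι → Subgroup P)
    (hS : ∀ i, IsClosed ((S i : Subgroup P) : Set P)) (T : ι' → Subgroup P')
    (hT : ∀ j, IsClosed ((T j : Subgroup P') : Set P'))
    (h : ∀ U : Subgroup P, U.Normal → IsOpen (U : Set P) →
      ∃ (K' : Subgroup P') (_ : K'.Normal)
        (e : (Σ i, DoubleCoset.Quotient (U : Set P) (S i : Set P)) ≃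
          (Σ j, DoubleCoset.Quotient ((U.map α.toMulEquiv.toMonoidHom : Subgroup P') : Set P')
            (T j : Set P'))),
        (∀ (i : ι) (x : P) (j : ι') (y : P'),
          e ⟨i, DoubleCoset.mk U (S i) x⟩ = ⟨j, DoubleCoset.mk (U.map α.toMulEquiv.toMonoidHom) (T j) y⟩ →
            ∃ u' ∈ U.map α.toMulEquiv.toMonoidHom,
              (U ⊓ ConjAct.toConjAct x • S i).map α.toMulEquiv.toMonoidHom ⊔ K' =
                ConjAct.toConjAct u' •
                  ((U.map α.toMulEquiv.toMonoidHom ⊓ ConjAct.toConjAct y • T j) ⊔ K')) ∧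
        (∀ (j₁ : ι') (y₁ : P') (j₂ : ι') (y₂ : P'),
          (∃ u' ∈ U.map α.toMulEquiv.toMonoidHom,
              (U.map α.toMulEquiv.toMonoidHom ⊓ ConjAct.toConjAct y₁ • T j₁) ⊔ K' =
                ConjAct.toConjAct u' •
                  ((U.map α.toMulEquiv.toMonoidHom ⊓ ConjAct.toConjAct y₂ • T j₂) ⊔ K')) →
            (⟨j₁, DoubleCoset.mk (U.map α.toMulEquiv.toMonoidHom) (T j₁) y₁⟩ :
                Σ j, DoubleCoset.Quotient ((U.map α.toMulEquiv.toMonoidHom : Subgroup P') : Set P')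
                  (T j : Set P')) =
              ⟨j₂, DoubleCoset.mk (U.map α.toMulEquiv.toMonoidHom) (T j₂) y₂⟩)) :
    (∀ A : Subgroup P, (∃ (i : ι) (γ : ConjAct P), A = γ • S i) →
        ∃ (j : ι') (δ : ConjAct P'), A.map α.toMulEquiv.toMonoidHom = δ • T j) ∧
      ∀ B : Subgroup P', (∃ (j : ι') (δ : ConjAct P'), B = δ • T j) →
        ∃ A : Subgroup P, (∃ (i : ι) (γ : ConjAct P), A = γ • S i) ∧
          A.map α.toMulEquiv.toMonoidHom = B := by
  refine transport_of_equivariant_bijections α S hS T hT fun U hUn hUo => ?_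
  obtain ⟨K', hK', e, he, hsep⟩ := h U hUn hUo
  exact ⟨e, fun g x i j y hxy => equivariant_of_graphic_mod α S T hUn
    (Subgroup.Normal.map hUn _ α.surjective) hK' e he hsep g x i j y hxy⟩

variable (G : PSCDatum P) (H : PSCDatum P')

/-- **[CombGC] Thm. 1.6 (ii), the descent to `α` (row T16-L09b), kernel form.**  Let `Π_G`, `Π_H` be
profinite and `α : Π_G ≅ Π_H`.  Suppose that at every level `U` (open normal in `Π_G`, `U' := α U`) there
are a normal subgroup `K'_U ≤ Π_H` and a bijection `Vert(G_U) ≃ Vert(H_{U'})` which is `α`-graphic modulo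
`K'_U` (for `U x Π_v ↦ U' y Π_w`: `α(U ⊓ Π_v^x) · K'_U` is `U'`-conjugate to `(U' ⊓ Π_w^y) · K'_U` — e.g. read
off from a GRAPHIC isomorphism of the compactifications `(G_U)' ≅ (H_{U'})'` induced by `α`, `K'_U` the
kernel of `Π_{H_{U'}} ↠ Π^cpt`) and such that distinct vertices of `H_{U'}` are separated modulo `K'_U`
(Prop. 1.2 (i) for `(H_{U'})'`).  Then `α` is group-theoretically verticial.
[cite: MochizukiCombGC2007, Thm 1.6(ii) p.14] -/
theorem isGroupTheoreticallyVerticial_of_graphic_mod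
    (h : ∀ U : Subgroup P, U.Normal → IsOpen (U : Set P) →
      ∃ (K' : Subgroup P') (_ : K'.Normal)
        (e : (Σ v, DoubleCoset.Quotient (U : Set P) (G.vertGp v : Set P)) ≃
          (Σ w, DoubleCoset.Quotient ((U.map α.toMulEquiv.toMonoidHom : Subgroup P') : Set P')
            (H.vertGp w : Set P'))),
        (∀ (v : G.graph.V) (x : P) (w : H.graph.V) (y : P'),
          e ⟨v, DoubleCoset.mk U (G.vertGp v) x⟩ =
              ⟨w, DoubleCoset.mk (U.map α.toMulEquiv.toMonoidHom) (H.vertGp w) y⟩ →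
            ∃ u' ∈ U.map α.toMulEquiv.toMonoidHom,
              (U ⊓ ConjAct.toConjAct x • G.vertGp v).map α.toMulEquiv.toMonoidHom ⊔ K' =
                ConjAct.toConjAct u' •
                  ((U.map α.toMulEquiv.toMonoidHom ⊓ ConjAct.toConjAct y • H.vertGp w) ⊔ K')) ∧
        (∀ (w₁ : H.graph.V) (y₁ : P') (w₂ : H.graph.V) (y₂ : P'),
          (∃ u' ∈ U.map α.toMulEquiv.toMonoidHom,
              (U.map α.toMulEquiv.toMonoidHom ⊓ ConjAct.toConjAct y₁ • H.vertGp w₁) ⊔ K' =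
                ConjAct.toConjAct u' •
                  ((U.map α.toMulEquiv.toMonoidHom ⊓ ConjAct.toConjAct y₂ • H.vertGp w₂) ⊔ K')) →
            (⟨w₁, DoubleCoset.mk (U.map α.toMulEquiv.toMonoidHom) (H.vertGp w₁) y₁⟩ :
                Σ w, DoubleCoset.Quotient ((U.map α.toMulEquiv.toMonoidHom : Subgroup P') : Set P')
                  (H.vertGp w : Set P')) =
              ⟨w₂, DoubleCoset.mk (U.map α.toMulEquiv.toMonoidHom) (H.vertGp w₂) y₂⟩)) :
    G.IsGroupTheoreticallyVerticial H α := by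
  obtain ⟨h₁, h₂⟩ := transport_of_graphic_mod α G.vertGp G.isClosed_vertGp H.vertGp H.isClosed_vertGp h
  exact ⟨fun A ⟨v, γ, hA⟩ => by obtain ⟨w, δ, h'⟩ := h₁ A ⟨v, γ, hA⟩; exact ⟨w, δ, h'⟩,
    fun B ⟨w, δ, hB⟩ => by
      obtain ⟨A, ⟨v, γ, hA⟩, hAB⟩ := h₂ B ⟨w, δ, hB⟩; exact ⟨A, ⟨v, γ, hA⟩, hAB⟩⟩

/-- **The same descent for the CUSPS** (proof of Thm. 1.6 (i), p. 13 l.−9: "it suffices to show that `α`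
induces a functorial bijection between the sets of cusps"): level-wise `α`-graphic-mod-`K'_U` bijections
of cusp sets with separation ⇒ `α` group-theoretically cuspidal. [cite: MochizukiCombGC2007, Thm 1.6(i) p.13] -/
theorem isGroupTheoreticallyCuspidal_of_graphic_mod
    (h : ∀ U : Subgroup P, U.Normal → IsOpen (U : Set P) →
      ∃ (K' : Subgroup P') (_ : K'.Normal)
        (e : (Σ c, DoubleCoset.Quotient (U : Set P) (G.cuspGp c : Set P)) ≃
          (Σ c', DoubleCoset.Quotient ((U.map α.toMulEquiv.toMonoidHom : Subgroup P') : Set P')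
            (H.cuspGp c' : Set P'))),
        (∀ (c : G.graph.C) (x : P) (c' : H.graph.C) (y : P'),
          e ⟨c, DoubleCoset.mk U (G.cuspGp c) x⟩ =
              ⟨c', DoubleCoset.mk (U.map α.toMulEquiv.toMonoidHom) (H.cuspGp c') y⟩ →
            ∃ u' ∈ U.map α.toMulEquiv.toMonoidHom,
              (U ⊓ ConjAct.toConjAct x • G.cuspGp c).map α.toMulEquiv.toMonoidHom ⊔ K' =
                ConjAct.toConjAct u' •
                  ((U.map α.toMulEquiv.toMonoidHom ⊓ ConjAct.toConjAct y • H.cuspGp c') ⊔ K')) ∧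
        (∀ (c₁ : H.graph.C) (y₁ : P') (c₂ : H.graph.C) (y₂ : P'),
          (∃ u' ∈ U.map α.toMulEquiv.toMonoidHom,
              (U.map α.toMulEquiv.toMonoidHom ⊓ ConjAct.toConjAct y₁ • H.cuspGp c₁) ⊔ K' =
                ConjAct.toConjAct u' •
                  ((U.map α.toMulEquiv.toMonoidHom ⊓ ConjAct.toConjAct y₂ • H.cuspGp c₂) ⊔ K')) →
            (⟨c₁, DoubleCoset.mk (U.map α.toMulEquiv.toMonoidHom) (H.cuspGp c₁) y₁⟩ :
                Σ c', DoubleCoset.Quotient ((U.map α.toMulEquiv.toMonoidHom : Subgroup P') : Set P')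
                  (H.cuspGp c' : Set P')) =
              ⟨c₂, DoubleCoset.mk (U.map α.toMulEquiv.toMonoidHom) (H.cuspGp c₂) y₂⟩)) :
    G.IsGroupTheoreticallyCuspidal H α := by
  obtain ⟨h₁, h₂⟩ := transport_of_graphic_mod α G.cuspGp G.isClosed_cuspGp H.cuspGp H.isClosed_cuspGp h
  exact ⟨fun A ⟨c, γ, hA⟩ => by obtain ⟨c', δ, h'⟩ := h₁ A ⟨c, γ, hA⟩; exact ⟨c', δ, h'⟩,
    fun B ⟨c', δ, hB⟩ => by
      obtain ⟨A, ⟨c, γ, hA⟩, hAB⟩ := h₂ B ⟨c', δ, hB⟩; exact ⟨A, ⟨c, γ, hA⟩, hAB⟩⟩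

/-- **The same descent for the EDGES** (nodes ⊔ cusps): level-wise `α`-graphic-mod-`K'_U` bijections of edge
sets with separation ⇒ `α` group-theoretically edge-like. [cite: MochizukiCombGC2007, Thm 1.6(ii) p.14] -/
theorem isGroupTheoreticallyEdgeLike_of_graphic_mod
    (h : ∀ U : Subgroup P, U.Normal → IsOpen (U : Set P) →
      ∃ (K' : Subgroup P') (_ : K'.Normal)
        (e : (Σ c, DoubleCoset.Quotient (U : Set P) (G.edgeGp c : Set P)) ≃
          (Σ c', DoubleCoset.Quotient ((U.map α.toMulEquiv.toMonoidHom : Subgroup P') : Set P')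
            (H.edgeGp c' : Set P'))),
        (∀ (c : G.graph.N ⊕ G.graph.C) (x : P) (c' : H.graph.N ⊕ H.graph.C) (y : P'),
          e ⟨c, DoubleCoset.mk U (G.edgeGp c) x⟩ =
              ⟨c', DoubleCoset.mk (U.map α.toMulEquiv.toMonoidHom) (H.edgeGp c') y⟩ →
            ∃ u' ∈ U.map α.toMulEquiv.toMonoidHom,
              (U ⊓ ConjAct.toConjAct x • G.edgeGp c).map α.toMulEquiv.toMonoidHom ⊔ K' =
                ConjAct.toConjAct u' •
                  ((U.map α.toMulEquiv.toMonoidHom ⊓ ConjAct.toConjAct y • H.edgeGp c') ⊔ K')) ∧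
        (∀ (c₁ : H.graph.N ⊕ H.graph.C) (y₁ : P') (c₂ : H.graph.N ⊕ H.graph.C) (y₂ : P'),
          (∃ u' ∈ U.map α.toMulEquiv.toMonoidHom,
              (U.map α.toMulEquiv.toMonoidHom ⊓ ConjAct.toConjAct y₁ • H.edgeGp c₁) ⊔ K' =
                ConjAct.toConjAct u' •
                  ((U.map α.toMulEquiv.toMonoidHom ⊓ ConjAct.toConjAct y₂ • H.edgeGp c₂) ⊔ K')) →
            (⟨c₁, DoubleCoset.mk (U.map α.toMulEquiv.toMonoidHom) (H.edgeGp c₁) y₁⟩ :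
                Σ c', DoubleCoset.Quotient ((U.map α.toMulEquiv.toMonoidHom : Subgroup P') : Set P')
                  (H.edgeGp c' : Set P')) =
              ⟨c₂, DoubleCoset.mk (U.map α.toMulEquiv.toMonoidHom) (H.edgeGp c₂) y₂⟩)) :
    G.IsGroupTheoreticallyEdgeLike H α := by
  obtain ⟨h₁, h₂⟩ := transport_of_graphic_mod α G.edgeGp G.isClosed_edgeGp H.edgeGp H.isClosed_edgeGp h
  refine ⟨fun A hA => ?_, fun B hB => ?_⟩
  · obtain ⟨c, γ, hA'⟩ := (G.isEdgeLike_iff_exists_edgeGp A).mp hA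
    obtain ⟨c', δ, h'⟩ := h₁ A ⟨c, γ, hA'⟩
    exact (H.isEdgeLike_iff_exists_edgeGp _).mpr ⟨c', δ, h'⟩
  · obtain ⟨c', δ, hB'⟩ := (H.isEdgeLike_iff_exists_edgeGp B).mp hB
    obtain ⟨A, ⟨c, γ, hA⟩, hAB⟩ := h₂ B ⟨c', δ, hB'⟩
    exact ⟨A, (G.isEdgeLike_iff_exists_edgeGp A).mpr ⟨c, γ, hA⟩, hAB⟩

end AllLevels

end PSCDatum

end Literature.AnabelianGeometry.SemiGraphs
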